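import Summits.QuantumFields.GaugeBoot.TiltedSiteRPPositivity
import Summits.QuantumFields.GaugeBoot.TiltedBox
import HarnessLib

/-!
# Site-hyperplane reflection positivity on the 45°-tilted periodic box, axes `k ∉ {i, j}`
(gauge-boot, L3(τ) part 5 — the theorem)

HONEST FRAMING (cell `pub-gaugeboot`, page 1 of every file): the venture produces certified bounds
on lattice expectations at stated coupling, gauge group, dimension and torus size; NOT a mass gap,
NOT a continuum limit, NOT a string tension; NOT Yang–Mills-summit-bearing (barriers
`FixedCouplingUltralocality`, `PerturbativeInvisibility`).

The tilted box `TiltedSite d i j M_u M_v L = ℤ^d / Γ`,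
`Γ = {2M_u ∣ x_i + x_j, 2M_v ∣ x_i - x_j, L ∣ x_k (k ∉ {i, j})}` (`TiltedBox.lean`), is an ordinary
periodic direction of period `L` along every axis `k ∉ {i, j}`. For EVEN `L = 2Q`, `Q ≥ 2`, the
reflection `x_k ↦ -x_k` (`tiltedReflect`) and the coordinate `x_k mod 2Q` (`tiltedCoord`) form a site
frame (`isSiteFrame_tiltedBox`; both layers `x_k ≡ 0, Q` are pointwise fixed since
`x - θx = 2 x_k e_k ∈ Γ` iff `Q ∣ x_k`), so `TiltedSiteRPPositivity.lean` gives: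

**Theorem (`tiltedBox_siteRP`).** For a compact second countable `G`, continuous `ρ`, `β ≥ 0`,
`k ∉ {i, j}`, `Q ≥ 2`: the Wilson measure of the tilted box with `L = 2Q` is reflection positive for
the Osterwalder–Seiler reflection in the lattice hyperplane `x_k = 0` (through sites; `k`-links
reversed and inverted): `0 ≤ ∫ conj F(ΘU) · F(U) dμ_β` for every bounded measurable `F` of the closed
half `{0 ≤ x_k ≤ Q (mod 2Q)}`; the site RP blocks are positive semidefinite
(`tiltedBox_rSiteBlock_nonneg`) and the measure is reflection invariant
(`tiltedBox_integral_comp_configReflect`).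

Together with `tiltedBox_diagonalRP` (`TiltedBox.lean`) and translation invariance
(`TiltedLatticeSymmetry.lean`) this is the exact positivity/symmetry input of a bootstrap on the
tilted box: Hausdorff/Gram positivity, translations, site RP along the axes `k ∉ {i, j}` (this file;
the link-hyperplane reflections `x_k = ½` are not treated), diagonal RP in `x_i = x_j`. The standard
torus statement (site planes: Lüscher 1977, Menotti–Pelissetto 1987 §2; link planes:
Osterwalder–Seiler 1978 Thm. 2.1, Seiler LNP 159; Glimm–Jaffe Thm. 7.10.2)
covers the cubic torus; this file is its verbatim analogue on the tilted box, which is not a cubic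
torus.

References: M. Lüscher, Comm. Math. Phys. 54 (1977) 283; P. Menotti, A. Pelissetto, Comm. Math. Phys.
113 (1987) 369, §2 (site reflections); K. Osterwalder, E. Seiler, Ann. Phys. 110 (1978) 440, §2;
J. Fröhlich, R. Israel, E. H. Lieb, B. Simon, Comm. Math. Phys. 62 (1978) 1, Thm. 2.1, and J. Stat. Phys.
22 (1980) 297, §3; V. Kazakov, Z. Zheng, arXiv:2203.11360 §3.1 (site reflections of the bootstrap).
-/

noncomputable section

open MeasureTheory Complex QuotientAddGroup
open scoped ComplexOrder ComplexConjugate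

namespace Summit.QuantumFields.GaugeBoot

namespace TiltedRP

/-! ## The coordinate reflection `x_k ↦ -x_k` and the coordinate `x_k` on the tilted box -/

section Frame

variable (d : ℕ) (i j : Fin d) (Mu Mv L : ℕ) (k : Fin d)

/-- The coordinate reflection `x_k ↦ -x_k` of `ℤ^d`. -/
def negHom : (Fin d → ℤ) →+ (Fin d → ℤ) where
  toFun x m := if m = k then -x m else x m
  map_zero' := by funext m; simp
  map_add' x y := by funext m; simp only [Pi.add_apply]; split_ifs <;> ring

/-- `negHom` evaluated. -/
@[simp] theorem negHom_apply (x : Fin d → ℤ) (m : Fin d) :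
    negHom d k x m = if m = k then -x m else x m := rfl

variable {i j k}

/-- `Γ` is invariant under `x_k ↦ -x_k` for `k ∉ {i, j}`. -/
theorem tiltedLattice_le_comap_negHom (hki : k ≠ i) (hkj : k ≠ j) :
    tiltedLattice d i j Mu Mv L ≤ (tiltedLattice d i j Mu Mv L).comap (negHom d k) := by
  intro x hx
  rw [AddSubgroup.mem_comap, mem_tiltedLattice_iff]
  rw [mem_tiltedLattice_iff] at hx
  obtain ⟨h1, h2, h3⟩ := hx
  simp only [negHom_apply, if_neg hki.symm, if_neg hkj.symm]
  refine ⟨h1, h2, fun m hmi hmj => ?_⟩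
  split_ifs
  · exact (h3 m hmi hmj).neg_right
  · exact h3 m hmi hmj

/-- **The site reflection of the tilted box along the axis `k ∉ {i, j}`**: `[x] ↦ [x_k ↦ -x_k]`. -/
def tiltedReflect (hki : k ≠ i) (hkj : k ≠ j) : TiltedSite d i j Mu Mv L →+ TiltedSite d i j Mu Mv L :=
  QuotientAddGroup.map _ _ (negHom d k) (tiltedLattice_le_comap_negHom d Mu Mv L hki hkj)

/-- **The coordinate `x_k mod L` of the tilted box** (`k ∉ {i, j}`). -/
def tiltedCoord (hki : k ≠ i) (hkj : k ≠ j) : TiltedSite d i j Mu Mv L →+ ZMod L :=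
  QuotientAddGroup.lift _ ((Int.castAddHom (ZMod L)).comp (Pi.evalAddMonoidHom (fun _ : Fin d => ℤ) k))
    (by
      intro x hx
      rw [mem_tiltedLattice_iff_cast] at hx
      rw [AddMonoidHom.mem_ker]
      simpa using hx.2.2 k hki hkj)

/-- The reflection on classes. -/
theorem tiltedReflect_mk (hki : k ≠ i) (hkj : k ≠ j) (x : Fin d → ℤ) :
    tiltedReflect d Mu Mv L hki hkj (x : TiltedSite d i j Mu Mv L) =
      ((negHom d k x : Fin d → ℤ) : TiltedSite d i j Mu Mv L) := rfl

/-- The coordinate on classes. -/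
theorem tiltedCoord_mk (hki : k ≠ i) (hkj : k ≠ j) (x : Fin d → ℤ) :
    tiltedCoord d Mu Mv L hki hkj (x : TiltedSite d i j Mu Mv L) = ((x k : ℤ) : ZMod L) := rfl

/-- `negHom` negates the unit vector `e_k` and fixes the others. -/
theorem negHom_single (l : Fin d) :
    negHom d k (Pi.single l (1 : ℤ)) = if l = k then -Pi.single k (1 : ℤ) else Pi.single l (1 : ℤ) := by
  funext m
  simp only [negHom_apply]
  by_cases hl : l = k
  · subst hl
    simp only [if_true, Pi.neg_apply]
    split_ifs with hm
    · subst hm; rfl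
    · rw [Pi.single_eq_of_ne hm, neg_zero]
  · rw [if_neg hl]
    split_ifs with hm
    · subst hm; rw [Pi.single_eq_of_ne (Ne.symm hl), neg_zero]
    · rfl

/-- **The layers `x_k ≡ 0` and `x_k ≡ Q (mod 2Q)` are pointwise fixed by the reflection**:
`x - (x_k ↦ -x_k) x = 2 x_k e_k ∈ Γ` as soon as `Q ∣ x_k` (`L = 2Q`). -/
theorem tiltedReflect_eq_self_of_layer {Q : ℕ} (hki : k ≠ i) (hkj : k ≠ j)
    (q : TiltedSite d i j Mu Mv (2 * Q))
    (hq : tiltedCoord d Mu Mv (2 * Q) hki hkj q = 0 ∨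
      tiltedCoord d Mu Mv (2 * Q) hki hkj q = ((Q : ℕ) : ZMod (2 * Q))) :
    tiltedReflect d Mu Mv (2 * Q) hki hkj q = q := by
  induction q using QuotientAddGroup.induction_on with
  | H x =>
    rw [tiltedReflect_mk, QuotientAddGroup.eq, mem_tiltedLattice_iff]
    rw [tiltedCoord_mk] at hq
    have hdvd : (Q : ℤ) ∣ x k := by
      rcases hq with h' | h'
      · have h'' := (ZMod.intCast_zmod_eq_zero_iff_dvd _ _).1 h'
        exact (Dvd.intro 2 (by push_cast; ring) : (Q : ℤ) ∣ ((2 * Q : ℕ) : ℤ)).trans h''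
      · have h1 : (((x k - Q : ℤ)) : ZMod (2 * Q)) = 0 := by
          push_cast at h' ⊢
          rw [h', sub_self]
        have h2 := (ZMod.intCast_zmod_eq_zero_iff_dvd _ _).1 h1
        have h3 : (Q : ℤ) ∣ x k - Q :=
          (Dvd.intro 2 (by push_cast; ring) : (Q : ℤ) ∣ ((2 * Q : ℕ) : ℤ)).trans h2
        simpa using h3.add (dvd_refl (Q : ℤ))
    have hi : (-(negHom d k x) + x) i = 0 := by simp [hki.symm]
    have hj : (-(negHom d k x) + x) j = 0 := by simp [hkj.symm]
    refine ⟨by rw [hi, hj, add_zero]; exact dvd_zero _, by rw [hi, hj, sub_zero]; exact dvd_zero _,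
      fun m hmi hmj => ?_⟩
    by_cases hm : m = k
    · subst hm
      obtain ⟨c, hc⟩ := hdvd
      refine ⟨c, ?_⟩
      simp only [Pi.neg_apply, Pi.add_apply, negHom_apply, if_true]
      push_cast
      linear_combination (2 : ℤ) * hc
    · have h0 : (-(negHom d k x) + x) m = 0 := by simp [hm]
      rw [h0]; exact dvd_zero _

/-- **The tilted box carries a site frame along every axis `k ∉ {i, j}`** (`L = 2Q`, `Q ≥ 2`). -/
theorem isSiteFrame_tiltedBox {Q : ℕ} (hki : k ≠ i) (hkj : k ≠ j) (hQ : 2 ≤ Q) :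
    IsSiteFrame (tiltedUnit d i j Mu Mv (2 * Q)) k (tiltedReflect d Mu Mv (2 * Q) hki hkj) Q
      (tiltedCoord d Mu Mv (2 * Q) hki hkj) where
  two_le := hQ
  map_e_self := by
    show tiltedReflect d Mu Mv (2 * Q) hki hkj
      ((Pi.single k (1 : ℤ) : Fin d → ℤ) : TiltedSite d i j Mu Mv (2 * Q)) = _
    rw [tiltedReflect_mk, negHom_single, if_pos rfl]
    rfl
  map_e_other l hl := by
    show tiltedReflect d Mu Mv (2 * Q) hki hkj
      ((Pi.single l (1 : ℤ) : Fin d → ℤ) : TiltedSite d i j Mu Mv (2 * Q)) = _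
    rw [tiltedReflect_mk, negHom_single, if_neg hl]
    rfl
  invol q := by
    induction q using QuotientAddGroup.induction_on with
    | H x =>
      rw [tiltedReflect_mk, tiltedReflect_mk]
      congr 1
      funext m
      simp only [negHom_apply]
      split_ifs <;> simp
  height_self := by
    show tiltedCoord d Mu Mv (2 * Q) hki hkj
      ((Pi.single k (1 : ℤ) : Fin d → ℤ) : TiltedSite d i j Mu Mv (2 * Q)) = 1
    rw [tiltedCoord_mk]
    simp
  height_other l hl := by
    show tiltedCoord d Mu Mv (2 * Q) hki hkj
      ((Pi.single l (1 : ℤ) : Fin d → ℤ) : TiltedSite d i j Mu Mv (2 * Q)) = 0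
    rw [tiltedCoord_mk]
    simp [Ne.symm hl]
  height_map q := by
    induction q using QuotientAddGroup.induction_on with
    | H x =>
      rw [tiltedReflect_mk, tiltedCoord_mk, tiltedCoord_mk]
      simp
  fix_of_layer q hq := tiltedReflect_eq_self_of_layer d Mu Mv hki hkj q hq

end Frame

/-! ## The theorem -/

section Main

variable {d : ℕ} {i j k : Fin d} {Mu Mv Q N : ℕ} [NeZero Mu] [NeZero Mv] [NeZero Q]
variable {G : Type*} [Group G] [TopologicalSpace G] [IsTopologicalGroup G] [CompactSpace G]
  [MeasurableSpace G] [BorelSpace G] [SecondCountableTopology G]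
variable (ρ : G →* Matrix (Fin N) (Fin N) ℂ)

/-- **Site-hyperplane reflection positivity of lattice Yang–Mills on the 45°-tilted periodic box,
along an axis `k ∉ {i, j}` of even period `2Q`** (Osterwalder–Seiler 1978 §2; FILS 1978 Thm. 2.1).
For a compact second countable `G`, continuous `ρ`, `β ≥ 0`, `Q ≥ 2` and every bounded measurable `F`
of the closed half `{0 ≤ x_k ≤ Q (mod 2Q)}`: `0 ≤ ∫ conj F(ΘU) · F(U) dμ_β(U)`, `Θ` the reflection
in the hyperplane `x_k = 0` (`k`-links reversed and inverted). -/
theorem tiltedBox_siteRP (hki : k ≠ i) (hkj : k ≠ j) (hQ : 2 ≤ Q) (hρ : Continuous ρ) {β : ℝ}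
    (hβ : 0 ≤ β) (F : Config (TiltedSite d i j Mu Mv (2 * Q)) d G → ℂ) (hFm : Measurable F)
    (hFb : ∃ C : ℝ, ∀ U, ‖F U‖ ≤ C)
    (hFo : IsHalfObservable (tiltedUnit d i j Mu Mv (2 * Q)) Q (tiltedCoord d Mu Mv (2 * Q) hki hkj) F) :
    0 ≤ ∫ U, conj (F (configReflect (tiltedUnit d i j Mu Mv (2 * Q)) k
        (tiltedReflect d Mu Mv (2 * Q) hki hkj) U)) * F U ∂(gibbs ρ (tiltedUnit d i j Mu Mv (2 * Q)) β) :=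
  (isSiteFrame_tiltedBox d Mu Mv hki hkj hQ).integral_conj_mul_nonneg ρ hρ hβ F hFm hFb hFo

/-- **The site RP blocks of the tilted box are positive semidefinite** (`k ∉ {i, j}`, `L = 2Q`,
`Q ≥ 2`, `β ≥ 0`): for bounded measurable half-space observables `F_1, …, F_n` and `c ∈ ℂ^n`,
`0 ≤ ∑_{a,b} conj c_a · c_b · ⟨conj(F_a ∘ Θ) F_b⟩_β`. -/
theorem tiltedBox_rSiteBlock_nonneg (hki : k ≠ i) (hkj : k ≠ j) (hQ : 2 ≤ Q) (hρ : Continuous ρ)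
    {β : ℝ} (hβ : 0 ≤ β) {n : ℕ} (F : Fin n → Config (TiltedSite d i j Mu Mv (2 * Q)) d G → ℂ)
    (hFm : ∀ a, Measurable (F a)) (hFb : ∀ a, ∃ C : ℝ, ∀ U, ‖F a U‖ ≤ C)
    (hFo : ∀ a, IsHalfObservable (tiltedUnit d i j Mu Mv (2 * Q)) Q
      (tiltedCoord d Mu Mv (2 * Q) hki hkj) (F a)) (c : Fin n → ℂ) :
    0 ≤ ∑ a, ∑ b, conj (c a) * c b *
      ∫ U, conj (F a (configReflect (tiltedUnit d i j Mu Mv (2 * Q)) k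
        (tiltedReflect d Mu Mv (2 * Q) hki hkj) U)) * F b U ∂(gibbs ρ (tiltedUnit d i j Mu Mv (2 * Q)) β) :=
  (isSiteFrame_tiltedBox d Mu Mv hki hkj hQ).sum_mul_conj_integral_nonneg ρ hρ hβ F hFm hFb hFo c

/-- **The Wilson measure of the tilted box is invariant under the site reflection `x_k ↦ -x_k`**
(`k ∉ {i, j}`, `L = 2Q`, `Q ≥ 2`; every real `β`, measurable real `F`). -/
theorem tiltedBox_integral_comp_configReflect (hki : k ≠ i) (hkj : k ≠ j) (hQ : 2 ≤ Q)
    (hρ : Continuous ρ) (β : ℝ) {F : Config (TiltedSite d i j Mu Mv (2 * Q)) d G → ℝ}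
    (hFm : Measurable F) :
    ∫ U, F (configReflect (tiltedUnit d i j Mu Mv (2 * Q)) k (tiltedReflect d Mu Mv (2 * Q) hki hkj) U)
        ∂(gibbs ρ (tiltedUnit d i j Mu Mv (2 * Q)) β) =
      ∫ U, F U ∂(gibbs ρ (tiltedUnit d i j Mu Mv (2 * Q)) β) :=
  (isSiteFrame_tiltedBox d Mu Mv hki hkj hQ).integral_comp_configReflect_gibbs ρ hρ β hFm

end Main

end TiltedRP

end Summit.QuantumFields.GaugeBoot
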